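import Summits.ResolutionOfSingularities.ResolutionOfSingularities.Theorems.MaxContactCutCompanionCut
import Summits.ResolutionOfSingularities.ResolutionOfSingularities.Theorems.SatelliteCutCells
import HarnessLib

/-!
# MaxContactCutSatelliteCut — decomp-res node «SatelliteCut» (lens-4 g28, critic row 164), tree file 5/5 of the node

Content VERBATIM from the decomp-res lens-4 g28 node `HOME/decomp-res-lens-4/g28/SatelliteCut.lean` (pin b83bf2f8 =
`parts/SatelliteCut-g28-b83bf2f8.lean`,
998 l; HOME = run/shared/lean/pub/decomp-res): ONE NEW PART §74–§77 = `parts/part_new-g28-3bc4b3a5.lean` (46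
declarations), typed against the LANDED
tree (the node imports `Theorems/DepthCutCells` + `Theorems/MaxContactCutCompanionCut` only; nothing carried, nothing inlined).
Critic: CRITIC-LEDGER row 164 (2026-08-31T01:23:24Z): CLEARED — DECIDED +1 · MAP 0 (the SATELLITE NO-JUMP LAW over
two consecutive blow-ups =
Hauser's kangaroo condition (3) in kernel, unconditional in the shallow prime-weight window; typed sub-cell `n.Prime
∧ SatelliteJumpTower n` of
`NoWildShallowCompanionKangarooTowers` EMPTY for every `n`; EXACT hypothesis-free re-location to
`NoWildFreeJumpShallowCompanionKangarooTowers`; entrances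
on both sides; census cross-check T-satellite (census-1 g23, `HOME/census/it/kangsat/T-satellite.md` 2d03875b)
confirmed 2/2 · 33/33 · 0/88).
Landing orders INBOX :651 (lens-4 g28 landing note, split per NEXT-g29 §3) and :659 (critic): `--kind proof
--supports stmt-ResolutionOfSingularities-28338`,
namespace `…Theorems.HugValuationCut`, canonical headers, one file per section (D-0064); files of the node:
`SatelliteAlgebra` (§74) · `SatelliteTransport` + `SatelliteTransport2` (§75) ·
`SatelliteCutCells` (§76–§77, cone-free cells: the aside home) · `MaxContactCutSatelliteCut` (the four §77
corollaries GIVEN 31571 `MaxContactCut.NoContactHuggingTowers`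
BY NAME — in the Theses cone, kept apart so that the route file can import the aside home without an import cycle,
as for `DepthCutCells` / `MaxContactCutDepthCut`).
Aside bookkeeping (row 164 / INBOX :659): ONE successor aside on the lens-4 column,
`NoWildFreeJumpShallowCompanionKangarooTowers` (home `SatelliteCutCells`),
SUPERSEDING g27's `NoWildShallowCompanionKangarooTowers` (exact hyp-free
`noWildShallowCompanionKangarooTowers_iff_g28`); the decided cell
`NoWildSatelliteJumpShallowTowers` is a THEOREM (`noWildSatelliteJumpShallowTowers_holds`) and is not filed.  TWO
TEXT FIXES at landing (docstrings only, ordered by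
the critic, row 164 / INBOX :659; no statement or proof changed): (i) the hand inhabitant in the docstring of
`WildFreeJumpShallowCompanionKangarooTowersTerminate`
is NODE-g28's isolated chain `Z² + U³ + U²T + T⁵ → z² + u²t + u³t + t³ → (z₁ + t)² + tv² + vt² + v²t² + v³t²` (the
lens text named a non-isolated polynomial);
(ii) the part's declaration count «42» → 46.

## This file

THE FOUR §77 COROLLARIES GIVEN 31571 `MaxContactCut.NoContactHuggingTowers` BY NAME (in the Theses cone):
`noWildKangarooOffDoublePointTowers_iff_g28 (h71)` · `noWildKangarooOffLocusTowers_iff_g28 (h71)` ·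
`noWildPPowerOffLocusTowers_iff_g28 (h71)` · `noWildContactFreeOffLocusTowers_iff_g28 (h71)` — TREE ASIDE 28338 /
the g25 / g26 / g27 residuals ⟺ the decided satellite cell ∧ the g28 located residual, through
`MaxContactCutCompanionCut`'s `noWildKangarooOffDoublePointTowers_iff_companion` / `…_iff_g26` and the
hypothesis-free `noWildCompanionKangarooTowers_iff_g28`.  Imports `MaxContactCutCompanionCut` + `SatelliteCutCells`; 0 sorry.

[WRITER NOTE (decomp-res writer g10): file split only (tree files ≤ 400 lines); namespace, universes, sections,
section variables and every declaration
exactly as in the lens (the node's global `set_option` and the `open …Theses` line live only in the wiring file; the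
pure-algebra file opens only what it uses).]

(Sources: Hauser2010Kangaroo (arXiv:0811.4151 p. 6, Kangaroo Theorem condition (3) + remark (a)); HauserPerlega2019
§2; Hauser2024 PRIMS 60; Moh1987; Matsumura1987 Thms. 14.2–14.3; ZariskiSamuel1960 VIII §11; StacksProject Tag 00NQ;
CossartPiltant2008 §2; Giraud1975.)
-/

noncomputable section

open CategoryTheory AlgebraicGeometry IsLocalRing
open Literature.AlgebraicGeometry.Resolution
open Summit.ResolutionOfSingularities.ResolutionOfSingularities.Theses
open Summit.ResolutionOfSingularities.ResolutionOfSingularities.Theorems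
open WeakOrderReduction ForcedTowerClasses DivergentTowerClasses MonomialTowerClasses
open HugDimensionClasses HugDimensionKernels SurfaceShadowClasses SurfaceShadowKernels
open NearPointCut (SingularClass)
open AbsoluteContactClasses (IsAbsContactAt SepResidueAt diffIdeal_restrict_le stalkMap_comp_toStalk_eq_stalkHom)
open scoped BigOperators

namespace Summit.ResolutionOfSingularities.ResolutionOfSingularities.Theorems.HugValuationCut

section SatelliteCells

/-- **GIVEN 31571 BY NAME: the g25 residual ⟺ the free-jump residual.** [folklore] -/
theorem noWildKangarooOffDoublePointTowers_iff_g28 (h71 : MaxContactCut.NoContactHuggingTowers) :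
    NoWildKangarooOffDoublePointTowers ↔ NoWildFreeJumpShallowCompanionKangarooTowers := by
  rw [noWildKangarooOffDoublePointTowers_iff_companion h71, noWildCompanionKangarooTowers_iff_g28]

/-- **GIVEN 31571 BY NAME: g24's kangaroo residual ⟺ the free-jump residual.** [folklore] -/
theorem noWildKangarooOffLocusTowers_iff_g28 (h71 : MaxContactCut.NoContactHuggingTowers) :
    NoWildKangarooOffLocusTowers ↔ NoWildFreeJumpShallowCompanionKangarooTowers := by
  rw [noWildKangarooOffLocusTowers_iff_g26 h71, noWildCompanionKangarooTowers_iff_g28]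

/-- **GIVEN 31571 BY NAME: g23's `p`-power residual ⟺ the free-jump residual.** [folklore] -/
theorem noWildPPowerOffLocusTowers_iff_g28 (h71 : MaxContactCut.NoContactHuggingTowers) :
    NoWildPPowerOffLocusTowers ↔ NoWildFreeJumpShallowCompanionKangarooTowers := by
  rw [noWildPPowerOffLocusTowers_iff_g26 h71, noWildCompanionKangarooTowers_iff_g28]

/-- **GIVEN 31571 BY NAME, THE TREE ASIDE 28338 ⟺ THE g28 RESIDUAL** — `NoWildContactFreeOffLocusTowers` ⟺ the free-jump
shallow companion-recurrent residual. [folklore] -/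
theorem noWildContactFreeOffLocusTowers_iff_g28 (h71 : MaxContactCut.NoContactHuggingTowers) :
    NoWildContactFreeOffLocusTowers ↔ NoWildFreeJumpShallowCompanionKangarooTowers := by
  rw [noWildContactFreeOffLocusTowers_iff_g26 h71, noWildCompanionKangarooTowers_iff_g28]

end SatelliteCells

end Summit.ResolutionOfSingularities.ResolutionOfSingularities.Theorems.HugValuationCut
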